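import Literature.Probability.RandomPlanarGeometry.JoukowskiEllipse
import Literature.Probability.RandomPlanarGeometry.HullApproximation
import HarnessLib

/-!
# Half-ellipse hulls and their restriction maps: the smooth hulls for [LSW] Lemma 2.1

Proof infrastructure (no named facts, everything PROVED) for the outer approximation of a
`+`-hull by smooth hulls in

* G. F. Lawler, O. Schramm, W. Werner, *Conformal restriction: the chordal case*, J. Amer. Math.
  Soc. **16** (2003), arXiv:math/0209343 (**[LSW]**), Lemma 2.1 (p. 8) and proof of Lemma 3.5
  (p. 13: the `δ`-neighbourhoods `D_δ` in `ℍ` of the segment `[Φ_A(x₀), Φ_A(x₁)]` and the hulls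
  `E_δ = cl(A ∪ Φ_A⁻¹(D_δ))`).

We replace the stadium-shaped `D_δ` by the closed half-ellipses with foci at the endpoints of a
segment `[a, b] ⊆ (0, ∞)`, which the Joukowski map makes explicit (`JoukowskiEllipse`):
with `c = (a+b)/2`, `h = (b-a)/4` and the similarity `ofNorm u = c + h u` (`toNorm` its inverse,
`normHomeo` the homeomorphism),

* `ellRegion a b ρ = {‖z - a‖ + ‖z - b‖ ≤ (b-a)(ρ + ρ⁻¹)/2}` (`mem_ellRegion_iff`), `ρ ∈ (0, 1)`:
  closed, bounded, NESTED in `ρ` (`ellRegion_mono`), a neighbourhood of `[a, b]`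
  (`mem_ellRegion_of_infDist_lt`), real parts of its points in `[c - h(ρ+ρ⁻¹), c + h(ρ+ρ⁻¹)]`,
  every point of `ℍ` eventually outside (`eventually_notMem_ellRegion`), and
  `ℍ ∩ ∂(ellRegion) = ellHullArc a b ρ '' (0, 1)` for the arc `ellHullArc = ofNorm ∘ ellArc ρ`
  (continuous, injective on `[0, 1]`, real endpoints `c ± h(ρ + ρ⁻¹)` outside `[a, b]`, interior in
  `ℍ`);
* `ellHull a b ρ = ellRegion a b ρ ∩ ℍ̄`, the **half-ellipse hull**: `cl(B ∩ ℍ) = B`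
  (`closure_ellHull_inter`), and under the condition `h(ρ + ρ⁻¹) < c` (all real points of `B` are
  positive) `B ∈ 𝒬₊` (`isPlusHull_ellHull`; simple connectivity of `ℍ ∖ B` through the conformal
  equivalence below);
* `ellMap a b ρ z = h (G_ρ(toNorm z) - G_ρ(toNorm 0))`, `G_ρ = jNorm ρ`: the **restriction map of
  `B`** as a conformal equivalence `ellConf : ℍ ∖ B → ℍ` (`ConformalEquiv.ofBijOn`), with
  `IsRestrictionMap` (`isRestrictionMap_ellConf`), `HasRestrictionDeriv … (ellDeriv a b ρ)` where
  `ellDeriv a b ρ = (1 - v₀²/ρ²)/(1 - v₀²) ∈ (0, 1]`, `v₀ = ellNode a b = J⁻¹(-c/h) ∈ (-ρ, 0)`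
  independent of `ρ`, INCREASING in `ρ` (`ellDeriv_mono`) with `ellDeriv a b 1 = 1`, and the
  uniform bound `‖ellMap z - z‖ ≤ 2h(ρ⁻² - 1)` (`norm_ellMap_sub_le`).

Mathlib: `affineHomeomorph`, `Homeomorph.preimage_frontier/interior`, `HasDerivAt.of_local_left_inverse`
(through `JoukowskiEllipse`); Literature: `ConformalEquiv.ofBijOn`, `Complex.differentiableOn_invFunOn_image`,
`ConformalEquiv.isSimplyConnected_iff`.
-/

noncomputable section

open Set Filter Topology Metric Bornology Complex
open UpperHalfPlane (upperHalfPlaneSet isOpen_upperHalfPlaneSet)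
open scoped ComplexConjugate Real

namespace Literature.Probability.RandomPlanarGeometry

/-! ### The similarity `u ↦ c + h u` carrying `[-2, 2]` onto `[a, b]` -/

section Affine

variable {a b : ℝ}

/-- The centre `c = (a + b)/2` of `[a, b]`. [folklore] -/
def ellC (a b : ℝ) : ℝ := (a + b) / 2

/-- The scale `h = (b - a)/4` (so that `[a, b] = c + h · [-2, 2]`). [folklore] -/
def ellH (a b : ℝ) : ℝ := (b - a) / 4

/-- `h > 0` for `a < b`. [folklore] -/
theorem ellH_pos (hab : a < b) : 0 < ellH a b := by rw [ellH]; linarith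

/-- `a = c - 2h`. [folklore] -/
theorem left_eq_ellC_sub (a b : ℝ) : a = ellC a b - 2 * ellH a b := by rw [ellC, ellH]; ring

/-- `b = c + 2h`. [folklore] -/
theorem right_eq_ellC_add (a b : ℝ) : b = ellC a b + 2 * ellH a b := by rw [ellC, ellH]; ring

/-- The normalising map `z ↦ (z - c)/h`. [folklore] -/
def toNorm (a b : ℝ) (z : ℂ) : ℂ := (z - ellC a b) / ellH a b

/-- The positioning map `u ↦ c + h u`. [folklore] -/
def ofNorm (a b : ℝ) (u : ℂ) : ℂ := ellC a b + ellH a b * u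

/-- The positioning similarity as a self-homeomorphism of `ℂ` (`u ↦ h u + c`). [folklore] -/
def normHomeo (hab : a < b) : ℂ ≃ₜ ℂ :=
  affineHomeomorph (ellH a b : ℂ) (ellC a b : ℂ) (ofReal_ne_zero.2 (ellH_pos hab).ne')

/-- The homeomorphism acts as `ofNorm`. [folklore] -/
theorem normHomeo_apply (hab : a < b) (u : ℂ) : normHomeo hab u = ofNorm a b u := by
  simp [normHomeo, ofNorm, add_comm]

/-- Its inverse acts as `toNorm`. [folklore] -/
theorem normHomeo_symm_apply (hab : a < b) (z : ℂ) : (normHomeo hab).symm z = toNorm a b z := by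
  simp [normHomeo, toNorm]

/-- `ofNorm (toNorm z) = z`. [folklore] -/
theorem ofNorm_toNorm (hab : a < b) (z : ℂ) : ofNorm a b (toNorm a b z) = z := by
  rw [← normHomeo_apply hab, ← normHomeo_symm_apply hab, Homeomorph.apply_symm_apply]

/-- `toNorm (ofNorm u) = u`. [folklore] -/
theorem toNorm_ofNorm (hab : a < b) (u : ℂ) : toNorm a b (ofNorm a b u) = u := by
  rw [← normHomeo_apply hab, ← normHomeo_symm_apply hab, Homeomorph.symm_apply_apply]

/-- `toNorm` is continuous. [folklore] -/
theorem continuous_toNorm (a b : ℝ) : Continuous (toNorm a b) := by unfold toNorm; fun_prop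

/-- `ofNorm` is continuous. [folklore] -/
theorem continuous_ofNorm (a b : ℝ) : Continuous (ofNorm a b) := by unfold ofNorm; fun_prop

/-- `im (toNorm z) = im z / h`. [folklore] -/
theorem toNorm_im (a b : ℝ) (z : ℂ) : (toNorm a b z).im = z.im / ellH a b := by
  rw [toNorm, div_ofReal_im, sub_im, ofReal_im, sub_zero]

/-- `im (ofNorm u) = h im u`. [folklore] -/
theorem ofNorm_im (a b : ℝ) (u : ℂ) : (ofNorm a b u).im = ellH a b * u.im := by
  rw [ofNorm, add_im, ofReal_im, zero_add, im_ofReal_mul]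

/-- `toNorm` preserves `ℍ` (`h > 0`). [folklore] -/
theorem toNorm_im_pos_iff (hab : a < b) {z : ℂ} : 0 < (toNorm a b z).im ↔ 0 < z.im := by
  rw [toNorm_im]
  exact ⟨fun h ↦ by
    by_contra hle
    push Not at hle
    exact absurd h (not_lt.2 (div_nonpos_of_nonpos_of_nonneg hle (ellH_pos hab).le)),
    fun h ↦ div_pos h (ellH_pos hab)⟩

/-- `toNorm` preserves the closed upper half-plane. [folklore] -/
theorem toNorm_im_nonneg_iff (hab : a < b) {z : ℂ} : 0 ≤ (toNorm a b z).im ↔ 0 ≤ z.im := by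
  rw [toNorm_im]
  exact ⟨fun h ↦ by
    by_contra hlt
    push Not at hlt
    exact absurd h (not_le.2 (div_neg_of_neg_of_pos hlt (ellH_pos hab))),
    fun h ↦ div_nonneg h (ellH_pos hab).le⟩

/-- `ofNorm` preserves `ℍ`. [folklore] -/
theorem ofNorm_im_pos_iff (hab : a < b) {u : ℂ} : 0 < (ofNorm a b u).im ↔ 0 < u.im := by
  rw [← toNorm_im_pos_iff hab, toNorm_ofNorm hab]

/-- `toNorm` on real points. [folklore] -/
theorem toNorm_ofReal (a b x : ℝ) : toNorm a b x = (((x - ellC a b) / ellH a b : ℝ) : ℂ) := by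
  rw [toNorm]; push_cast; ring

/-- `ofNorm` on real points. [folklore] -/
theorem ofNorm_ofReal (a b x : ℝ) : ofNorm a b x = ((ellC a b + ellH a b * x : ℝ) : ℂ) := by
  rw [ofNorm]; push_cast; ring

/-- `toNorm 0 = -c/h`. [folklore] -/
theorem toNorm_zero (a b : ℝ) : toNorm a b 0 = ((-(ellC a b / ellH a b) : ℝ) : ℂ) := by
  rw [show (0 : ℂ) = ((0 : ℝ) : ℂ) from rfl, toNorm_ofReal]
  congr 1
  ring

/-- `toNorm` scales distances by `h⁻¹`. [folklore] -/
theorem dist_toNorm (hab : a < b) (z w : ℂ) : dist (toNorm a b z) (toNorm a b w) = dist z w / ellH a b := by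
  rw [dist_eq_norm, dist_eq_norm, toNorm, toNorm, ← sub_div, norm_div, norm_real,
    Real.norm_of_nonneg (ellH_pos hab).le]
  congr 1
  ring_nf

/-- `toNorm` maps `[a, b]` into `[-2, 2]`. [folklore] -/
theorem toNorm_mem_realSeg (hab : a < b) {x : ℝ} (hx : x ∈ Icc a b) : toNorm a b x ∈ realSeg (-2) 2 := by
  rw [toNorm_ofReal]
  refine ofReal_mem_realSeg.2 ?_
  rw [uIcc_of_le (by norm_num : (-2 : ℝ) ≤ 2)]
  have hh := ellH_pos hab
  constructor
  · rw [le_div_iff₀ hh, ellC, ellH]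
    rw [ellH] at hh
    linarith [hx.1]
  · rw [div_le_iff₀ hh, ellC, ellH]
    linarith [hx.2]

/-- The focal sum after normalisation: `h f(toNorm z) = ‖z - a‖ + ‖z - b‖`. [folklore] -/
theorem focalSum_toNorm (hab : a < b) (z : ℂ) : ellH a b * focalSum (toNorm a b z) = ‖z - a‖ + ‖z - b‖ := by
  have hh := ellH_pos hab
  have hba : (b : ℂ) - a ≠ 0 := sub_ne_zero.2 (fun h ↦ hab.ne' (by exact_mod_cast h))
  have e1 : toNorm a b z - 2 = (z - b) / ellH a b := by
    rw [toNorm, ellC, ellH]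
    push_cast
    field_simp
    ring
  have e2 : toNorm a b z + 2 = (z - a) / ellH a b := by
    rw [toNorm, ellC, ellH]
    push_cast
    field_simp
    ring
  rw [focalSum, e1, e2, norm_div, norm_div, norm_real, Real.norm_of_nonneg hh.le]
  field_simp
  ring

end Affine

/-! ### The confocal ellipses `N(a, b; ρ)` around `[a, b]` and the half-ellipse hulls -/

section Region

variable {a b ρ : ℝ}

/-- **The confocal ellipse `N(a,b;ρ) = {‖z - a‖ + ‖z - b‖ ≤ ((b - a)/2)(ρ + ρ⁻¹)}`** with foci
`a, b` (`ρ ∈ (0, 1)`): the positioned Joukowski ellipse `c + h N(ρ)`. These decrease to `[a, b]`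
as `ρ ↑ 1`. [folklore] -/
def ellRegion (a b ρ : ℝ) : Set ℂ := {z | toNorm a b z ∈ jEllipse ρ}

/-- **The half-ellipse hull `B(a,b;ρ) = N(a,b;ρ) ∩ ℍ̄`.** [folklore] -/
def ellHull (a b ρ : ℝ) : Set ℂ := ellRegion a b ρ ∩ {z | 0 ≤ z.im}

/-- Membership in `N(a,b;ρ)` in terms of the distances to the foci. [folklore] -/
theorem mem_ellRegion_iff (hab : a < b) {z : ℂ} :
    z ∈ ellRegion a b ρ ↔ ‖z - a‖ + ‖z - b‖ ≤ (b - a) / 2 * jLevel ρ := by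
  rw [ellRegion, mem_setOf_eq, mem_jEllipse_iff, ← focalSum_toNorm hab,
    show (b - a) / 2 * jLevel ρ = ellH a b * (2 * jLevel ρ) by rw [ellH]; ring]
  exact (mul_le_mul_iff_of_pos_left (ellH_pos hab)).symm

/-- `N(a,b;ρ)` as a preimage under the normalising homeomorphism. [folklore] -/
theorem ellRegion_eq_preimage (hab : a < b) : ellRegion a b ρ = (normHomeo hab).symm ⁻¹' jEllipse ρ := by
  ext z
  rw [mem_preimage, normHomeo_symm_apply]
  rfl

/-- `N(a,b;ρ)` is closed. [folklore] -/
theorem isClosed_ellRegion (a b ρ : ℝ) : IsClosed (ellRegion a b ρ) :=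
  (isClosed_jEllipse ρ).preimage (continuous_toNorm a b)

/-- `B(a,b;ρ)` is closed. [folklore] -/
theorem isClosed_ellHull (a b ρ : ℝ) : IsClosed (ellHull a b ρ) :=
  (isClosed_ellRegion a b ρ).inter (isClosed_le continuous_const continuous_im)

/-- `N(a,b;ρ)` is bounded. [folklore] -/
theorem isBounded_ellRegion (hab : a < b) (ρ : ℝ) : IsBounded (ellRegion a b ρ) := by
  have : ellRegion a b ρ = ofNorm a b '' jEllipse ρ := by
    ext z
    constructor
    · intro hz
      exact ⟨toNorm a b z, hz, ofNorm_toNorm hab z⟩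
    · rintro ⟨u, hu, rfl⟩
      show toNorm a b (ofNorm a b u) ∈ jEllipse ρ
      rwa [toNorm_ofNorm hab]
  rw [this]
  have hlip : LipschitzWith ⟨|ellH a b|, abs_nonneg _⟩ (ofNorm a b) := by
    refine LipschitzWith.of_dist_le_mul fun u v ↦ ?_
    rw [dist_eq_norm, dist_eq_norm, ofNorm, ofNorm, show (ellC a b : ℂ) + ellH a b * u - (ellC a b + ellH a b * v)
      = ellH a b * (u - v) by ring, norm_mul, norm_real, Real.norm_eq_abs]
    rfl
  exact hlip.isBounded_image (isBounded_jEllipse ρ)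

/-- `B(a,b;ρ)` is bounded. [folklore] -/
theorem isBounded_ellHull (hab : a < b) (ρ : ℝ) : IsBounded (ellHull a b ρ) :=
  (isBounded_ellRegion hab ρ).subset inter_subset_left

/-- In `ℍ`, `B` and `N` agree. [folklore] -/
theorem mem_ellHull_iff_of_im_pos {z : ℂ} (hz : 0 < z.im) : z ∈ ellHull a b ρ ↔ z ∈ ellRegion a b ρ :=
  ⟨fun h ↦ h.1, fun h ↦ ⟨h, hz.le⟩⟩

/-- **The ellipses are nested**: `N(a,b;s) ⊆ N(a,b;r)` for `r ≤ s` in `(0, 1]`. [folklore] -/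
theorem ellRegion_mono {r s : ℝ} (hr : 0 < r) (hrs : r ≤ s) (hs : s ≤ 1) : ellRegion a b s ⊆ ellRegion a b r :=
  fun _ hz ↦ jEllipse_mono hr hrs hs hz

/-- The hulls are nested. [folklore] -/
theorem ellHull_mono {r s : ℝ} (hr : 0 < r) (hrs : r ≤ s) (hs : s ≤ 1) : ellHull a b s ⊆ ellHull a b r :=
  inter_subset_inter_left _ (ellRegion_mono hr hrs hs)

/-- **Real points of `N(a,b;ρ)` lie in `[c - h(ρ + ρ⁻¹), c + h(ρ + ρ⁻¹)]`.** [folklore] -/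
theorem ofReal_mem_ellRegion (hab : a < b) {x : ℝ} (hx : (x : ℂ) ∈ ellRegion a b ρ) :
    ellC a b - ellH a b * jLevel ρ ≤ x ∧ x ≤ ellC a b + ellH a b * jLevel ρ := by
  have h1 : toNorm a b x ∈ jEllipse ρ := hx
  rw [toNorm_ofReal] at h1
  have h2 := abs_le_jLevel_of_ofReal_mem_jEllipse h1
  rw [abs_le] at h2
  have hh := ellH_pos hab
  rw [div_le_iff₀ hh] at h2
  rw [le_div_iff₀ hh] at h2
  constructor <;> nlinarith [h2.1, h2.2]

/-- Points of `N(a,b;ρ)` have real part in `[c - h(ρ + ρ⁻¹), c + h(ρ + ρ⁻¹)]`. [folklore] -/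
theorem re_bounds_of_mem_ellRegion (hab : a < b) {z : ℂ} (hz : z ∈ ellRegion a b ρ) :
    ellC a b - ellH a b * jLevel ρ ≤ z.re ∧ z.re ≤ ellC a b + ellH a b * jLevel ρ := by
  have h1 : ‖toNorm a b z‖ ≤ jLevel ρ := norm_le_of_mem_jEllipse hz
  have h2 : |(toNorm a b z).re| ≤ jLevel ρ := (abs_re_le_norm _).trans h1
  have hre : (toNorm a b z).re = (z.re - ellC a b) / ellH a b := by
    rw [toNorm, div_ofReal_re, sub_re, ofReal_re]
  rw [hre, abs_le] at h2
  have hh := ellH_pos hab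
  rw [div_le_iff₀ hh] at h2
  rw [le_div_iff₀ hh] at h2
  constructor <;> nlinarith [h2.1, h2.2]

/-- **`N(a,b;ρ)` is a neighbourhood of `[a, b]`**: the `δ`-neighbourhood of `[a, b]` lies in it
for `δ ≤ h(ρ + ρ⁻¹ - 2)`. [folklore] -/
theorem mem_ellRegion_of_infDist_lt (hab : a < b) {δ : ℝ} (hδ : δ ≤ ellH a b * (jLevel ρ - 2)) {w : ℂ}
    (hw : infDist w (realSeg a b) < δ) : w ∈ ellRegion a b ρ := by
  have hne : (realSeg a b).Nonempty := ⟨a, ofReal_mem_realSeg.2 left_mem_uIcc⟩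
  obtain ⟨_, ⟨x, hx, rfl⟩, hwx⟩ := (infDist_lt_iff hne).1 hw
  rw [uIcc_of_le hab.le] at hx
  have hh := ellH_pos hab
  have h1 : dist (toNorm a b w) (toNorm a b x) < δ / ellH a b := by
    rw [dist_toNorm hab]
    exact div_lt_div_of_pos_right hwx hh
  have h2 : infDist (toNorm a b w) (realSeg (-2) 2) < δ / ellH a b :=
    lt_of_le_of_lt (infDist_le_dist_of_mem (toNorm_mem_realSeg hab hx)) h1
  refine mem_jEllipse_of_infDist_lt ?_ h2
  rw [div_le_iff₀ hh]
  linarith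

/-- `[a, b] ⊆ N(a,b;ρ)` for `ρ ∈ (0, 1)`. [folklore] -/
theorem realSeg_subset_ellRegion (hab : a < b) (h0 : 0 < ρ) (h1 : ρ < 1) : realSeg a b ⊆ ellRegion a b ρ := by
  intro w hw
  refine mem_ellRegion_of_infDist_lt hab le_rfl ?_
  rw [infDist_zero_of_mem hw]
  exact mul_pos (ellH_pos hab) (by linarith [two_lt_jLevel h0 h1])

/-- **A point of `ℍ` lies outside `N(a,b;ρ)` for all `ρ` close to `1`.** [folklore] -/
theorem eventually_notMem_ellRegion (hab : a < b) {ζ : ℂ} (hζ : 0 < ζ.im) :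
    ∀ᶠ ρ in 𝓝[<] (1 : ℝ), ζ ∉ ellRegion a b ρ :=
  eventually_notMem_jEllipse ((toNorm_im_pos_iff hab).2 hζ)

/-! #### The boundary arc and the frontier in `ℍ` -/

/-- **The upper boundary arc `β(t) = c + h J(ρ e^{-iπt})`** of `B(a,b;ρ)`, `t ∈ [0, 1]`: from the
real point `c + h(ρ + ρ⁻¹) > b` through `ℍ` to the real point `c - h(ρ + ρ⁻¹) < a`. [folklore] -/
def ellHullArc (a b ρ : ℝ) (t : ℝ) : ℂ := ofNorm a b (ellArc ρ t)

/-- The arc is continuous. [folklore] -/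
theorem continuous_ellHullArc (a b : ℝ) (h0 : 0 < ρ) : Continuous (ellHullArc a b ρ) :=
  (continuous_ofNorm a b).comp (continuous_ellArc h0)

/-- The arc is injective on `[0, 1]`. [folklore] -/
theorem injOn_ellHullArc (hab : a < b) (h0 : 0 < ρ) : InjOn (ellHullArc a b ρ) (Icc 0 1) := by
  intro s hs t ht hst
  have := congrArg (toNorm a b) hst
  rw [ellHullArc, ellHullArc, toNorm_ofNorm hab, toNorm_ofNorm hab] at this
  exact injOn_ellArc h0 hs ht this

/-- The interior of the arc lies in `ℍ`. [folklore] -/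
theorem ellHullArc_im_pos (hab : a < b) (h0 : 0 < ρ) (h1 : ρ < 1) {t : ℝ} (ht : t ∈ Ioo (0 : ℝ) 1) :
    0 < (ellHullArc a b ρ t).im :=
  (ofNorm_im_pos_iff hab).2 (ellArc_im_pos h0 h1 ht)

/-- The left-hand real endpoint value `c - h(ρ + ρ⁻¹)` (attained at `t = 1`). [folklore] -/
theorem ellHullArc_one (a b : ℝ) (h0 : 0 < ρ) :
    ellHullArc a b ρ 1 = ((ellC a b - ellH a b * jLevel ρ : ℝ) : ℂ) := by
  rw [ellHullArc, ellArc_one h0, ofNorm_ofReal]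
  congr 1
  ring

/-- The right-hand real endpoint value `c + h(ρ + ρ⁻¹)` (attained at `t = 0`). [folklore] -/
theorem ellHullArc_zero (a b : ℝ) (h0 : 0 < ρ) :
    ellHullArc a b ρ 0 = ((ellC a b + ellH a b * jLevel ρ : ℝ) : ℂ) := by
  rw [ellHullArc, ellArc_zero h0, ofNorm_ofReal]

/-- The endpoints are real. [folklore] -/
theorem ellHullArc_im_eq_zero (a b : ℝ) (h0 : 0 < ρ) {t : ℝ} (ht : t = 0 ∨ t = 1) : (ellHullArc a b ρ t).im = 0 := by
  rcases ht with rfl | rfl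
  · rw [ellHullArc_zero a b h0, ofReal_im]
  · rw [ellHullArc_one a b h0, ofReal_im]

/-- The left endpoint is `< a` and the right endpoint is `> b` (`ρ < 1`). [folklore] -/
theorem ellHullArc_endpoints (hab : a < b) (h0 : 0 < ρ) (h1 : ρ < 1) :
    ellC a b - ellH a b * jLevel ρ < a ∧ b < ellC a b + ellH a b * jLevel ρ := by
  have hh := ellH_pos hab
  have hL := two_lt_jLevel h0 h1
  have ha : a = ellC a b - 2 * ellH a b := left_eq_ellC_sub a b
  have hb : b = ellC a b + 2 * ellH a b := right_eq_ellC_add a b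
  constructor <;> nlinarith

/-- **The part of `∂N(a,b;ρ)` in `ℍ` is the open arc `β(0,1)`.** [folklore] -/
theorem upperHalfPlaneSet_inter_frontier_ellRegion (hab : a < b) (h0 : 0 < ρ) (h1 : ρ < 1) :
    upperHalfPlaneSet ∩ frontier (ellRegion a b ρ) = ellHullArc a b ρ '' Ioo 0 1 := by
  rw [ellRegion_eq_preimage hab, ← Homeomorph.preimage_frontier]
  ext z
  constructor
  · rintro ⟨hz, hfr⟩
    rw [mem_preimage, normHomeo_symm_apply] at hfr
    have hmem : toNorm a b z ∈ upperHalfPlaneSet ∩ frontier (jEllipse ρ) := ⟨(toNorm_im_pos_iff hab).2 hz, hfr⟩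
    rw [upperHalfPlaneSet_inter_frontier_jEllipse h0 h1] at hmem
    obtain ⟨t, ht, hteq⟩ := hmem
    refine ⟨t, ht, ?_⟩
    rw [ellHullArc, hteq, ofNorm_toNorm hab]
  · rintro ⟨t, ht, rfl⟩
    refine ⟨ellHullArc_im_pos hab h0 h1 ht, ?_⟩
    rw [mem_preimage, normHomeo_symm_apply, ellHullArc, toNorm_ofNorm hab]
    have : ellArc ρ t ∈ upperHalfPlaneSet ∩ frontier (jEllipse ρ) := by
      rw [upperHalfPlaneSet_inter_frontier_jEllipse h0 h1]
      exact ⟨t, ht, rfl⟩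
    exact this.2

/-- For `ζ ∈ ℍ`: `ζ ∈ interior N(a,b;ρ) ↔ f(toNorm ζ) < 2(ρ + ρ⁻¹)`. [folklore] -/
theorem mem_interior_ellRegion_iff (hab : a < b) (h0 : 0 < ρ) (h1 : ρ ≤ 1) {ζ : ℂ} (hζ : 0 < ζ.im) :
    ζ ∈ interior (ellRegion a b ρ) ↔ focalSum (toNorm a b ζ) < 2 * jLevel ρ := by
  rw [ellRegion_eq_preimage hab, ← Homeomorph.preimage_interior, mem_preimage, normHomeo_symm_apply]
  exact mem_interior_jEllipse_iff_of_im_pos h0 h1 ((toNorm_im_pos_iff hab).2 hζ)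

/-! #### `B(a,b;ρ)` is the closure of its part in `ℍ` -/

/-- On `ℝ` with `|x| ≥ 2` the focal sum is `2|x|`. [folklore] -/
theorem focalSum_ofReal_of_two_le_abs {x : ℝ} (hx : 2 ≤ |x|) : focalSum x = 2 * |x| := by
  rw [focalSum, show (x : ℂ) - 2 = ((x - 2 : ℝ) : ℂ) by push_cast; ring,
    show (x : ℂ) + 2 = ((x + 2 : ℝ) : ℂ) by push_cast; ring, norm_real, norm_real,
    Real.norm_eq_abs, Real.norm_eq_abs]
  rcases le_abs'.1 hx with h | h
  · rw [abs_of_nonpos (by linarith), abs_of_nonpos (by linarith), abs_of_nonpos (by linarith)]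
    ring
  · rw [abs_of_nonneg (by linarith), abs_of_nonneg (by linarith), abs_of_nonneg (by linarith)]
    ring

/-- Real points of `N(ρ) ∩ ℍ̄` are limits of points of `N(ρ) ∩ ℍ` (normalised form). [folklore] -/
theorem ofReal_mem_closure_jEllipse_inter {x : ℝ} (h0 : 0 < ρ) (h1 : ρ < 1) (hx : (x : ℂ) ∈ jEllipse ρ) :
    (x : ℂ) ∈ closure (jEllipse ρ ∩ upperHalfPlaneSet) := by
  have hL := abs_le_jLevel_of_ofReal_mem_jEllipse hx
  rcases hL.lt_or_eq with hlt | heq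
  · -- interior point: vertical approach
    have hfs : focalSum x < 2 * jLevel ρ := by
      rcases le_or_gt 2 |x| with h2 | h2
      · rw [focalSum_ofReal_of_two_le_abs h2]; linarith
      · rw [focalSum_ofReal_of_abs_le h2.le]; linarith [two_lt_jLevel h0 h1]
    have hopen : IsOpen {u : ℂ | focalSum u < 2 * jLevel ρ} := isOpen_lt continuous_focalSum continuous_const
    have hpath : Tendsto (fun t : ℝ ↦ (x : ℂ) + t * I) (𝓝[>] 0) (𝓝 (x : ℂ)) := by
      have : Continuous fun t : ℝ ↦ (x : ℂ) + t * I := by fun_prop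
      simpa using (this.tendsto 0).mono_left nhdsWithin_le_nhds
    refine mem_closure_of_tendsto hpath ?_
    filter_upwards [hpath (hopen.mem_nhds hfs), self_mem_nhdsWithin] with t ht ht0
    exact ⟨mem_jEllipse_iff.2 (le_of_lt ht), show 0 < ((x : ℂ) + t * I).im by simpa using ht0⟩
  · -- a vertex `±(ρ + ρ⁻¹)`: approach along the arc
    have hcont := continuous_ellArc h0
    rcases le_abs'.1 heq.ge with hneg | hpos
    · have hx1 : (x : ℂ) = ellArc ρ 1 := by
        rw [ellArc_one h0]
        congr 1
        have : x ≤ -jLevel ρ := hneg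
        have : -jLevel ρ ≤ x := by rw [abs_le] at hL; exact hL.1
        linarith
      rw [hx1]
      have hpath : Tendsto (ellArc ρ) (𝓝[<] 1) (𝓝 (ellArc ρ 1)) := (hcont.tendsto 1).mono_left nhdsWithin_le_nhds
      refine mem_closure_of_tendsto hpath ?_
      filter_upwards [Ioo_mem_nhdsLT (zero_lt_one' ℝ)] with t ht
      exact ⟨ellArc_mem_jEllipse h0 t, ellArc_im_pos h0 h1 ht⟩
    · have hx0 : (x : ℂ) = ellArc ρ 0 := by
        rw [ellArc_zero h0]
        congr 1
        have : jLevel ρ ≤ x := hpos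
        linarith [le_abs_self x]
      rw [hx0]
      have hpath : Tendsto (ellArc ρ) (𝓝[>] 0) (𝓝 (ellArc ρ 0)) := (hcont.tendsto 0).mono_left nhdsWithin_le_nhds
      refine mem_closure_of_tendsto hpath ?_
      filter_upwards [Ioo_mem_nhdsGT (zero_lt_one' ℝ)] with t ht
      exact ⟨ellArc_mem_jEllipse h0 t, ellArc_im_pos h0 h1 ht⟩

/-- **`B(a,b;ρ) = cl(B ∩ ℍ)`.** [folklore] -/
theorem closure_ellHull_inter (hab : a < b) (h0 : 0 < ρ) (h1 : ρ < 1) :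
    closure (ellHull a b ρ ∩ upperHalfPlaneSet) = ellHull a b ρ := by
  refine Subset.antisymm (closure_minimal inter_subset_left (isClosed_ellHull a b ρ)) fun z hz ↦ ?_
  rcases (show 0 ≤ z.im from hz.2).lt_or_eq with hpos | hzero
  · exact subset_closure ⟨hz, hpos⟩
  · have hzre : ((z.re : ℝ) : ℂ) = z := Complex.ext (by simp) (by simp [← hzero])
    have hx : (toNorm a b z : ℂ) ∈ jEllipse ρ := hz.1
    rw [← hzre, toNorm_ofReal] at hx
    have hcl := ofReal_mem_closure_jEllipse_inter h0 h1 hx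
    -- transport the closure through the homeomorphism
    have himage : ellHull a b ρ ∩ upperHalfPlaneSet = normHomeo hab '' (jEllipse ρ ∩ upperHalfPlaneSet) := by
      ext w
      constructor
      · rintro ⟨hw, hwH⟩
        refine ⟨toNorm a b w, ⟨hw.1, (toNorm_im_pos_iff hab).2 hwH⟩, ?_⟩
        rw [normHomeo_apply, ofNorm_toNorm hab]
      · rintro ⟨u, ⟨hu, huH⟩, rfl⟩
        rw [normHomeo_apply]
        have h' : 0 < (ofNorm a b u).im := (ofNorm_im_pos_iff hab).2 huH
        exact ⟨⟨show toNorm a b (ofNorm a b u) ∈ jEllipse ρ by rwa [toNorm_ofNorm hab], h'.le⟩, h'⟩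
    rw [himage, ← Homeomorph.image_closure]
    refine ⟨_, hcl, ?_⟩
    rw [normHomeo_apply, ← toNorm_ofReal, hzre, ofNorm_toNorm hab]

end Region

/-! ### The restriction map of the half-ellipse hull -/

section Maps

variable {a b ρ : ℝ}

/-- The open set `{z | toNorm z ∈ W}` on which the restriction map is holomorphic; it contains
`ℍ` and (for `a > 0`) the origin. [folklore] -/
def ellDomain (a b : ℝ) : Set ℂ := {z | toNorm a b z ∈ jImage}

/-- `ellDomain` is open. [folklore] -/
theorem isOpen_ellDomain (a b : ℝ) : IsOpen (ellDomain a b) := isOpen_jImage.preimage (continuous_toNorm a b)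

/-- `ℍ ⊆ ellDomain`. [folklore] -/
theorem upperHalfPlaneSet_subset_ellDomain (hab : a < b) : upperHalfPlaneSet ⊆ ellDomain a b := fun _ hz ↦
  upperHalfPlaneSet_subset_jImage ((toNorm_im_pos_iff hab).2 hz)

/-- `c - 2h = a`, so `-c/h < -2` iff `a > 0`. [folklore] -/
theorem toNorm_zero_lt (hab : a < b) (ha : 0 < a) : -(ellC a b / ellH a b) < -2 := by
  have hh := ellH_pos hab
  have : 2 < ellC a b / ellH a b := by
    rw [lt_div_iff₀ hh, ellC, ellH]
    rw [ellH] at hh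
    linarith
  linarith

/-- **The node `v₀ = J⁻¹(-c/h) ∈ (-1, 0)`**, the preimage of the origin in normalised coordinates;
it depends on `a, b` only. [folklore] -/
def ellNode (a b : ℝ) : ℝ := (jInv (toNorm a b 0)).re

/-- The node: `-1 < v₀ < 0`, `toNorm 0 ∈ W`, `J⁻¹(toNorm 0) = v₀`. [folklore] -/
theorem ellNode_spec (hab : a < b) (ha : 0 < a) :
    -1 < ellNode a b ∧ ellNode a b < 0 ∧ toNorm a b 0 ∈ jImage ∧ jInv (toNorm a b 0) = ellNode a b := by
  obtain ⟨v, hv1, hv0, hW, hj, -⟩ := jInv_ofReal_of_lt (toNorm_zero_lt hab ha)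
  rw [← toNorm_zero] at hW hj
  have hnode : ellNode a b = v := by rw [ellNode, hj, ofReal_re]
  rw [hnode]
  exact ⟨hv1, hv0, hW, hj⟩

/-- `0 ∈ ellDomain` for `a > 0`. [folklore] -/
theorem zero_mem_ellDomain (hab : a < b) (ha : 0 < a) : (0 : ℂ) ∈ ellDomain a b := (ellNode_spec hab ha).2.2.1

/-- **The number `Φ_B'(0) = (1 - v₀²/ρ²)/(1 - v₀²)`** of the half-ellipse hull `B(a,b;ρ)`. [folklore] -/
def ellDeriv (a b ρ : ℝ) : ℝ := (1 - ellNode a b ^ 2 / ρ ^ 2) / (1 - ellNode a b ^ 2)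

/-- The positivity condition `h(ρ + ρ⁻¹) < c` (all real points of `B` are positive) implies `a > 0`. [folklore] -/
theorem pos_of_cond (hab : a < b) (h0 : 0 < ρ) (h1 : ρ ≤ 1) (hB : ellH a b * jLevel ρ < ellC a b) : 0 < a := by
  have hh := ellH_pos hab
  have hL := two_le_jLevel h0 h1
  rw [left_eq_ellC_sub a b]
  nlinarith

/-- Under the positivity condition, `-ρ < v₀`, and the real data of `G_ρ` at `toNorm 0`. [folklore] -/
theorem ellNode_data (hab : a < b) (h0 : 0 < ρ) (h1 : ρ ≤ 1) (hB : ellH a b * jLevel ρ < ellC a b) :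
    -ρ < ellNode a b ∧ ellNode a b < 0 ∧
      jNorm ρ (toNorm a b 0) = ((ellNode a b / ρ ^ 2 + (ellNode a b)⁻¹ : ℝ) : ℂ) ∧
      deriv (jNorm ρ) (toNorm a b 0) = (ellDeriv a b ρ : ℂ) := by
  have hh := ellH_pos hab
  have hx : -(ellC a b / ellH a b) < -jLevel ρ := by
    have : jLevel ρ < ellC a b / ellH a b := by rw [lt_div_iff₀ hh]; linarith
    linarith
  obtain ⟨v, hvρ, hv0, hW, hj, hval, hder⟩ := jNorm_ofReal_data h0 h1 hx
  rw [← toNorm_zero] at hW hj hval hder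
  have hnode : ellNode a b = v := by rw [ellNode, hj, ofReal_re]
  rw [ellDeriv, hnode]
  exact ⟨hvρ, hv0, hval, hder⟩

/-- `0 < Φ_B'(0) ≤ 1`. [folklore] -/
theorem ellDeriv_pos_le (hab : a < b) (h0 : 0 < ρ) (h1 : ρ ≤ 1) (hB : ellH a b * jLevel ρ < ellC a b) :
    0 < ellDeriv a b ρ ∧ ellDeriv a b ρ ≤ 1 := by
  obtain ⟨hvρ, hv0, -, -⟩ := ellNode_data hab h0 h1 hB
  set v := ellNode a b
  have hv2 : v ^ 2 < ρ ^ 2 := by nlinarith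
  have hρ2 : ρ ^ 2 ≤ 1 := by nlinarith
  have hden : 0 < 1 - v ^ 2 := by nlinarith
  have hnum : 0 < 1 - v ^ 2 / ρ ^ 2 := by
    rw [sub_pos, div_lt_one (by positivity)]
    exact hv2
  refine ⟨div_pos hnum hden, ?_⟩
  rw [ellDeriv, div_le_one hden]
  have : v ^ 2 ≤ v ^ 2 / ρ ^ 2 := by
    rw [le_div_iff₀ (by positivity)]
    nlinarith [sq_nonneg v]
  linarith

/-- **`Φ_B'(0)` increases with `ρ`** (the hulls `B(a,b;ρ)` decrease). [folklore] -/
theorem ellDeriv_mono (hab : a < b) (ha : 0 < a) {r s : ℝ} (hr : 0 < r) (hrs : r ≤ s) :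
    ellDeriv a b r ≤ ellDeriv a b s := by
  obtain ⟨hv1, hv0, -, -⟩ := ellNode_spec hab ha
  set v := ellNode a b
  have hden : 0 < 1 - v ^ 2 := by nlinarith
  rw [ellDeriv, ellDeriv, div_le_div_iff_of_pos_right hden, sub_le_sub_iff_left]
  exact div_le_div_of_nonneg_left (sq_nonneg v) (by positivity) (by nlinarith)

/-- `Φ_B'(0) → 1` as `ρ → 1`. [folklore] -/
theorem tendsto_ellDeriv (a b : ℝ) : Tendsto (ellDeriv a b) (𝓝 1) (𝓝 (ellDeriv a b 1)) := by
  have : ContinuousAt (ellDeriv a b) 1 := by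
    unfold ellDeriv
    refine ContinuousAt.div_const (ContinuousAt.sub continuousAt_const ?_) _
    exact ContinuousAt.div continuousAt_const (continuousAt_id.pow 2) (by norm_num)
  exact this.tendsto

/-- `ellDeriv a b 1 = 1` (for `a > 0`). [folklore] -/
theorem ellDeriv_one (hab : a < b) (ha : 0 < a) : ellDeriv a b 1 = 1 := by
  obtain ⟨hv1, hv0, -, -⟩ := ellNode_spec hab ha
  have hden : (1 : ℝ) - ellNode a b ^ 2 ≠ 0 := by nlinarith
  rw [ellDeriv, one_pow, div_one, div_self hden]

/-- **The restriction map `Φ_B(z) = h (G_ρ(toNorm z) - G_ρ(toNorm 0))`** of the half-ellipse hull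
`B(a,b;ρ)`. [folklore] -/
def ellMap (a b ρ : ℝ) (z : ℂ) : ℂ := ellH a b * (jNorm ρ (toNorm a b z) - jNorm ρ (toNorm a b 0))

/-- `Φ_B(0) = 0`. [folklore] -/
@[simp] theorem ellMap_zero (a b ρ : ℝ) : ellMap a b ρ 0 = 0 := by simp [ellMap]

/-- `toNorm` has derivative `h⁻¹`. [folklore] -/
theorem hasDerivAt_toNorm (a b : ℝ) (z : ℂ) : HasDerivAt (toNorm a b) ((ellH a b : ℂ)⁻¹) z := by
  unfold toNorm
  simpa using ((hasDerivAt_id z).sub_const (ellC a b : ℂ)).div_const (ellH a b : ℂ)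

/-- **`Φ_B` is holomorphic on `ellDomain`, with `Φ_B'(z) = G_ρ'(toNorm z)`.** [folklore] -/
theorem hasDerivAt_ellMap (hab : a < b) {z : ℂ} (hz : z ∈ ellDomain a b) :
    HasDerivAt (ellMap a b ρ) (deriv (jNorm ρ) (toNorm a b z)) z := by
  have hh : (ellH a b : ℂ) ≠ 0 := ofReal_ne_zero.2 (ellH_pos hab).ne'
  have h1 : HasDerivAt (fun w ↦ jNorm ρ (toNorm a b w)) (deriv (jNorm ρ) (toNorm a b z) * (ellH a b : ℂ)⁻¹) z :=
    (hasDerivAt_jNorm hz).deriv ▸ ((hasDerivAt_jNorm hz).comp z (hasDerivAt_toNorm a b z))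
  have h2 := (h1.sub_const (jNorm ρ (toNorm a b 0))).const_mul (ellH a b : ℂ)
  refine h2.congr_deriv ?_
  field_simp

/-- `Φ_B` is holomorphic on `ellDomain`. [folklore] -/
theorem differentiableOn_ellMap (hab : a < b) : DifferentiableOn ℂ (ellMap a b ρ) (ellDomain a b) :=
  fun _ hz ↦ (hasDerivAt_ellMap hab hz).differentiableAt.differentiableWithinAt

/-- `Φ_B' ≠ 0` on `ℍ ∖ B`. [folklore] -/
theorem deriv_ellMap_ne_zero (hab : a < b) (h0 : 0 < ρ) (h1 : ρ ≤ 1) {z : ℂ}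
    (hz : z ∈ upperHalfPlaneSet \ ellHull a b ρ) : deriv (ellMap a b ρ) z ≠ 0 := by
  have hzD := upperHalfPlaneSet_subset_ellDomain hab hz.1
  rw [(hasDerivAt_ellMap hab hzD).deriv]
  refine deriv_jNorm_ne_zero h0 hzD ?_
  have hu : toNorm a b z ∈ upperHalfPlaneSet \ jEllipse ρ :=
    ⟨(toNorm_im_pos_iff hab).2 hz.1, fun h ↦ hz.2 ⟨h, le_of_lt (show (0 : ℝ) < z.im from hz.1)⟩⟩
  exact (jInv_mem_lowerDisc h0 h1 hu).1

/-- `toNorm` maps `ℍ ∖ B` bijectively onto `ℍ ∖ N(ρ)`. [folklore] -/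
theorem bijOn_toNorm (hab : a < b) : BijOn (toNorm a b) (upperHalfPlaneSet \ ellHull a b ρ) (upperHalfPlaneSet \ jEllipse ρ) := by
  refine ⟨fun z hz ↦ ⟨(toNorm_im_pos_iff hab).2 hz.1, fun h ↦ hz.2 ⟨h, le_of_lt (show (0 : ℝ) < z.im from hz.1)⟩⟩,
    fun z _ w _ h ↦ ?_, fun u hu ↦ ?_⟩
  · have := congrArg (ofNorm a b) h
    rwa [ofNorm_toNorm hab, ofNorm_toNorm hab] at this
  · refine ⟨ofNorm a b u, ⟨(ofNorm_im_pos_iff hab).2 hu.1, fun h ↦ hu.2 ?_⟩, toNorm_ofNorm hab u⟩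
    have := h.1
    rwa [show ofNorm a b u ∈ ellRegion a b ρ ↔ toNorm a b (ofNorm a b u) ∈ jEllipse ρ from Iff.rfl,
      toNorm_ofNorm hab] at this

/-- **`Φ_B` maps `ℍ ∖ B` bijectively onto `ℍ`.** [folklore] -/
theorem bijOn_ellMap (hab : a < b) (h0 : 0 < ρ) (h1 : ρ ≤ 1) (hB : ellH a b * jLevel ρ < ellC a b) :
    BijOn (ellMap a b ρ) (upperHalfPlaneSet \ ellHull a b ρ) upperHalfPlaneSet := by
  obtain ⟨-, -, hval, -⟩ := ellNode_data hab h0 h1 hB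
  set C : ℝ := ellNode a b / ρ ^ 2 + (ellNode a b)⁻¹ with hC
  have hh := ellH_pos hab
  have hlast : BijOn (fun w : ℂ ↦ (ellH a b : ℂ) * (w - C)) upperHalfPlaneSet upperHalfPlaneSet := by
    refine ⟨fun w hw ↦ ?_, fun w _ w' _ h ↦ ?_, fun ζ hζ ↦ ?_⟩
    · show 0 < ((ellH a b : ℂ) * (w - C)).im
      rw [im_ofReal_mul, sub_im, ofReal_im, sub_zero]
      exact mul_pos hh hw
    · have h' := mul_left_cancel₀ (ofReal_ne_zero.2 hh.ne') h
      exact sub_left_injective h'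
    · refine ⟨ζ / ellH a b + C, ?_, ?_⟩
      · show 0 < (ζ / ellH a b + C).im
        rw [add_im, ofReal_im, add_zero, div_ofReal_im]
        exact div_pos hζ hh
      · show (ellH a b : ℂ) * (ζ / ellH a b + C - C) = ζ
        have hh0 : (ellH a b : ℂ) ≠ 0 := ofReal_ne_zero.2 hh.ne'
        rw [add_sub_cancel_right, mul_div_cancel₀ _ hh0]
  have hcomp := hlast.comp ((bijOn_jNorm h0 h1).comp (bijOn_toNorm hab))
  refine hcomp.congr fun z _ ↦ ?_
  show (ellH a b : ℂ) * (jNorm ρ (toNorm a b z) - C) = ellMap a b ρ z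
  rw [ellMap, hval]

/-- `ℍ ∖ B` is open. [folklore] -/
theorem isOpen_diff_ellHull (a b ρ : ℝ) : IsOpen (upperHalfPlaneSet \ ellHull a b ρ) :=
  isOpen_upperHalfPlaneSet.sdiff (isClosed_ellHull a b ρ)

/-- **The restriction map `Φ_B : ℍ ∖ B → ℍ` of the half-ellipse hull `B = B(a,b;ρ)`, as a conformal
equivalence.** [folklore] -/
def ellConf (hab : a < b) (h0 : 0 < ρ) (h1 : ρ ≤ 1) (hB : ellH a b * jLevel ρ < ellC a b) :
    ConformalEquiv (upperHalfPlaneSet \ ellHull a b ρ) upperHalfPlaneSet :=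
  ConformalEquiv.ofBijOn (ellMap a b ρ)
    ((differentiableOn_ellMap hab).mono fun _ hz ↦ upperHalfPlaneSet_subset_ellDomain hab hz.1)
    (bijOn_ellMap hab h0 h1 hB) (by
      have key := Complex.differentiableOn_invFunOn_image (isOpen_diff_ellHull a b ρ)
        ((differentiableOn_ellMap hab).mono fun _ hz ↦ upperHalfPlaneSet_subset_ellDomain hab hz.1)
        (bijOn_ellMap hab h0 h1 hB).injOn fun _ hz ↦ deriv_ellMap_ne_zero hab h0 h1 hz
      rwa [(bijOn_ellMap hab h0 h1 hB).image_eq] at key)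

/-- `Φ_B` acts as `ellMap`. [folklore] -/
@[simp] theorem ellConf_apply (hab : a < b) (h0 : 0 < ρ) (h1 : ρ ≤ 1) (hB : ellH a b * jLevel ρ < ellC a b) (z : ℂ) :
    ellConf hab h0 h1 hB z = ellMap a b ρ z := rfl

/-- **Real points of `B(a,b;ρ)` are at least `c - h(ρ + ρ⁻¹) > 0`.** [folklore] -/
theorem ellHull_ofReal_pos (hab : a < b) (hB : ellH a b * jLevel ρ < ellC a b) {x : ℝ}
    (hx : (x : ℂ) ∈ ellHull a b ρ) : 0 < x := by
  have := (ofReal_mem_ellRegion hab hx.1).1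
  linarith

/-- **`B(a,b;ρ)` is a `*`-hull** (`ℍ ∖ B ≅ ℍ` conformally, so it is simply connected). [folklore] -/
theorem isStarHull_ellHull (hab : a < b) (h0 : 0 < ρ) (h1 : ρ < 1) (hB : ellH a b * jLevel ρ < ellC a b) :
    IsStarHull (ellHull a b ρ) := by
  refine ⟨⟨isBounded_ellHull hab ρ, closure_ellHull_inter hab h0 h1, ?_⟩, fun h ↦ ?_⟩
  · exact (ellConf hab h0 h1.le hB).isSimplyConnected_iff.2 isSimplyConnected_upperHalfPlaneSet
  · have := ellHull_ofReal_pos hab hB (x := 0) (by simpa using h)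
    exact lt_irrefl _ this

/-- `B(a,b;ρ)` is a `+`-hull. [folklore] -/
theorem isPlusHull_ellHull (hab : a < b) (h0 : 0 < ρ) (h1 : ρ < 1) (hB : ellH a b * jLevel ρ < ellC a b) :
    IsPlusHull (ellHull a b ρ) :=
  ⟨isStarHull_ellHull hab h0 h1 hB, fun _ hx ↦ ellHull_ofReal_pos hab hB hx⟩

/-- **The uniform bound `‖Φ_B(z) - z‖ ≤ 2h(ρ⁻² - 1)`** on `ellDomain` (in particular on `ℍ ∖ B`):
`Φ_B(z) - z = h(G_ρ(u) - u) - h(G_ρ(u₀) - u₀)` with `u = toNorm z`, `u₀ = toNorm 0`. [folklore] -/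
theorem norm_ellMap_sub_le (hab : a < b) (h0 : 0 < ρ) (h1 : ρ ≤ 1) (ha : 0 < a) {z : ℂ} (hz : z ∈ ellDomain a b) :
    ‖ellMap a b ρ z - z‖ ≤ 2 * ellH a b * ((ρ ^ 2)⁻¹ - 1) := by
  have hh := ellH_pos hab
  have h0D := zero_mem_ellDomain hab ha
  have hC : 0 ≤ (ρ ^ 2)⁻¹ - 1 := by
    have : ρ ^ 2 ≤ 1 := by nlinarith
    have := (one_le_inv₀ (by positivity)).2 this
    linarith
  have hz' : z = ofNorm a b (toNorm a b z) := (ofNorm_toNorm hab z).symm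
  have h00 : (0 : ℂ) = ofNorm a b (toNorm a b 0) := (ofNorm_toNorm hab 0).symm
  have key : ellMap a b ρ z - z = ellH a b * (jNorm ρ (toNorm a b z) - toNorm a b z) -
      ellH a b * (jNorm ρ (toNorm a b 0) - toNorm a b 0) := by
    have e : ellMap a b ρ z - z = ellMap a b ρ z - ofNorm a b (toNorm a b z) + ofNorm a b (toNorm a b 0) := by
      rw [← hz', ← h00, add_zero]
    rw [e, ellMap, ofNorm, ofNorm]
    ring
  rw [key]
  have b1 := norm_jNorm_sub_le h0 h1 hz
  have b2 := norm_jNorm_sub_le h0 h1 h0D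
  have n1 := norm_jInv_lt_one hz
  have n2 := norm_jInv_lt_one h0D
  calc ‖ellH a b * (jNorm ρ (toNorm a b z) - toNorm a b z) - ellH a b * (jNorm ρ (toNorm a b 0) - toNorm a b 0)‖
      ≤ ‖(ellH a b : ℂ) * (jNorm ρ (toNorm a b z) - toNorm a b z)‖ + ‖(ellH a b : ℂ) * (jNorm ρ (toNorm a b 0) - toNorm a b 0)‖ :=
        norm_sub_le _ _
    _ = ellH a b * ‖jNorm ρ (toNorm a b z) - toNorm a b z‖ + ellH a b * ‖jNorm ρ (toNorm a b 0) - toNorm a b 0‖ := by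
        rw [norm_mul, norm_mul, norm_real, Real.norm_of_nonneg hh.le]
    _ ≤ ellH a b * (1 * ((ρ ^ 2)⁻¹ - 1)) + ellH a b * (1 * ((ρ ^ 2)⁻¹ - 1)) := by
        gcongr
        · exact b1.trans (by nlinarith)
        · exact b2.trans (by nlinarith)
    _ = 2 * ellH a b * ((ρ ^ 2)⁻¹ - 1) := by ring

/-- **`Φ_B` is a restriction map of `B(a,b;ρ)`**: boundary value `0` at `0` (holomorphic there) and
`Φ_B(z)/z → 1` at `∞` (`Φ_B(z) - z` is bounded). [folklore] -/
theorem isRestrictionMap_ellConf (hab : a < b) (h0 : 0 < ρ) (h1 : ρ < 1) (hB : ellH a b * jLevel ρ < ellC a b) :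
    IsRestrictionMap (ellHull a b ρ) (ellConf hab h0 h1.le hB) := by
  have ha := pos_of_cond hab h0 h1.le hB
  refine ⟨?_, ?_⟩
  · show Tendsto (ellMap a b ρ) (𝓝[upperHalfPlaneSet \ ellHull a b ρ] 0) (𝓝 0)
    have := (hasDerivAt_ellMap (ρ := ρ) hab (zero_mem_ellDomain hab ha)).continuousAt.tendsto
    rw [ellMap_zero] at this
    exact this.mono_left nhdsWithin_le_nhds
  · show Tendsto (fun z ↦ ellMap a b ρ z / z) (cocompact ℂ ⊓ 𝓟 (upperHalfPlaneSet \ ellHull a b ρ)) (𝓝 1)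
    set K : ℝ := 2 * ellH a b * ((ρ ^ 2)⁻¹ - 1) with hK
    have hK0 : 0 ≤ K := by
      have : ρ ^ 2 ≤ 1 := by nlinarith
      have := (one_le_inv₀ (by positivity)).2 this
      have := ellH_pos hab
      rw [hK]; nlinarith
    rw [Metric.tendsto_nhds]
    intro ε hε
    have hev : ∀ᶠ z in cocompact ℂ ⊓ 𝓟 (upperHalfPlaneSet \ ellHull a b ρ),
        K / ε + 1 ≤ ‖z‖ ∧ z ∈ upperHalfPlaneSet \ ellHull a b ρ := by
      refine Filter.eventually_inf_principal.2 ?_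
      rw [← cobounded_eq_cocompact]
      filter_upwards [(Filter.hasBasis_cobounded_norm (E := ℂ)).mem_of_mem (i := K / ε + 1) trivial] with u hu hu'
      exact ⟨hu, hu'⟩
    filter_upwards [hev] with z ⟨hz, hzU⟩
    have hzpos : 0 < ‖z‖ := by
      have : 0 ≤ K / ε := div_nonneg hK0 hε.le
      linarith
    have hz0 : z ≠ 0 := norm_pos_iff.1 hzpos
    rw [dist_eq_norm, show ellMap a b ρ z / z - 1 = (ellMap a b ρ z - z) / z by field_simp, norm_div,
      div_lt_iff₀ hzpos]
    have h2 := norm_ellMap_sub_le hab h0 h1.le ha (upperHalfPlaneSet_subset_ellDomain hab hzU.1) (ρ := ρ)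
    have h4 : K < ε * ‖z‖ := by
      have : K / ε < ‖z‖ := by linarith
      rwa [div_lt_iff₀' hε] at this
    linarith

/-- **`Φ_B'(0) = ellDeriv a b ρ`** in the sense of `HasRestrictionDeriv` (`Φ_B` is holomorphic at
`0` with `Φ_B(0) = 0`). [folklore] -/
theorem hasRestrictionDeriv_ellConf (hab : a < b) (h0 : 0 < ρ) (h1 : ρ < 1) (hB : ellH a b * jLevel ρ < ellC a b) :
    HasRestrictionDeriv (ellHull a b ρ) (ellConf hab h0 h1.le hB) (ellDeriv a b ρ) := by
  have ha := pos_of_cond hab h0 h1.le hB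
  show Tendsto (fun z ↦ ellMap a b ρ z / z) (𝓝[upperHalfPlaneSet \ ellHull a b ρ] 0) (𝓝 (ellDeriv a b ρ : ℂ))
  obtain ⟨-, -, -, hder⟩ := ellNode_data hab h0 h1.le hB
  have hd : HasDerivAt (ellMap a b ρ) (ellDeriv a b ρ : ℂ) 0 := by
    rw [← hder]
    exact hasDerivAt_ellMap hab (zero_mem_ellDomain hab ha)
  have hslope := hd.tendsto_slope_zero
  simp only [zero_add, ellMap_zero, sub_zero, smul_eq_mul] at hslope
  have h2 : Tendsto (fun z ↦ ellMap a b ρ z / z) (𝓝[≠] 0) (𝓝 (ellDeriv a b ρ : ℂ)) :=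
    hslope.congr fun z ↦ by rw [div_eq_inv_mul]
  refine h2.mono_left (nhdsWithin_mono _ fun z hz ↦ ?_)
  rintro (rfl : z = 0)
  exact absurd hz.1 (by simp [upperHalfPlaneSet])

end Maps

end Literature.Probability.RandomPlanarGeometry
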